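import Summits.AtomisticToContinuum.FouriersLaw.Theorems.HonestZwanzigOpenChainGreenKuboSkeleton
import Summits.AtomisticToContinuum.FouriersLaw.Theorems.HonestZwanzigOpenChainGreenKuboStar
import Summits.AtomisticToContinuum.FouriersLaw.Theorems.HonestZwanzigOpenChainGreenKuboKDN
import Summits.AtomisticToContinuum.FouriersLaw.Theorems.HonestZwanzigOpenChainGreenKuboUniformDecay

/-!
# `OpenChainGreenKubo` (stmt-AtomisticToContinuum-12696): the Kundu–Dhar–Narayan identity modulo ONE dynamical input

Helper file (`--supports`) for the support item `HonestZwanzig.OpenChainGreenKubo`, composing the four sibling files: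
the reduction skeleton (`…Skeleton`), the exact response identity ★ (`…Star`, PROVED), the KDN identity (`…KDN`, PROVED)
and the reduction of the continuity hypothesis to a uniform relaxation estimate (`…UniformDecay`, PROVED). Results:

* `openChainGreenKubo_of_cont` — the route decl follows from (CONT) alone: continuity at `δ = 0` (along `δ ≠ 0`) of
  `δ ↦ ∫₀^∞ ∫ g · (P^{T+δ/2,T-δ/2}_s J) dμ_T ds` for all parameters, `T > 0`, `N ≥ 2`;
* `openChainGreenKubo_of_uniformDecay` — the route decl follows from (UH): for all parameters, `T > 0`, `N ≥ 2`, a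
  UNIFORM-in-`δ` exponential relaxation `|P^{T+δ/2,T-δ/2}_t J(z) - m_δ| ≤ C e^{ϑH(z)} e^{-ct}` (`|δ| ≤ δ₀`) of the forecast
  of the total current — CEHR 2018 (2.5) at each fixed `δ` is in the tree; the local uniformity of its constants in the
  bath temperatures is the one input of the item that is not.

No definitions; no named facts are introduced (the hypotheses are spelled out).
-/

noncomputable section

open MeasureTheory Filter Topology Set
open scoped NNReal BigOperators

namespace Summit.AtomisticToContinuum.FouriersLaw.Theorems.OpenChainGreenKubo

open Literature.MathematicalPhysics.KineticTheory.HeatConduction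

/-- **`OpenChainGreenKubo` from the continuity hypothesis (CONT) alone** (★ and KDN being proved):
if for all parameters `> 0`, `T > 0`, `N ≥ 2` the NESS-kernel pairing `δ ↦ ∫₀^∞ ∫ g (P^{T+δ/2,T-δ/2}_s J) dμ_T ds` tends,
as `δ → 0` (`δ ≠ 0`), to its value at the equilibrium kernels, then the route decl holds.
[cite: KunduDharNarayan2009, p. 3] -/
theorem openChainGreenKubo_of_cont
    (hcont : ∀ ω₂ lam β γ : ℝ, 0 < ω₂ → 0 < lam → 0 < β → 0 < γ →
      ∀ T : ℝ, 0 < T → ∀ (N : ℕ) (hN : 2 ≤ N),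
        Tendsto (fun δ : ℝ => ∫ s in Ioi (0 : ℝ), ∫ x,
            γ / 2 * (x.2 ⟨0, by omega⟩ ^ 2 - x.2 ⟨N - 1, by omega⟩ ^ 2) *
              (∫ y, (∑ i : Fin N, (pinnedChain ω₂ lam β γ).bondCurrent N i y)
                ∂((pinnedChain ω₂ lam β γ).transitionKernel N (T + δ / 2) (T - δ / 2) s.toNNReal x))
            ∂((pinnedChain ω₂ lam β γ).gibbsMeasure N T))
          (𝓝[≠] 0)
          (𝓝 (∫ s in Ioi (0 : ℝ), ∫ x,
            γ / 2 * (x.2 ⟨0, by omega⟩ ^ 2 - x.2 ⟨N - 1, by omega⟩ ^ 2) *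
              (∫ y, (∑ i : Fin N, (pinnedChain ω₂ lam β γ).bondCurrent N i y)
                ∂((pinnedChain ω₂ lam β γ).transitionKernel N T T s.toNNReal x))
            ∂((pinnedChain ω₂ lam β γ).gibbsMeasure N T)))) :
    Summit.AtomisticToContinuum.FouriersLaw.Theses.HonestZwanzig.OpenChainGreenKubo := by
  refine openChainGreenKubo_of_star_of_cont_of_kdn ?_ hcont ?_
  · intro ω₂ lam β γ hω hl hβ hγ huniq μf hμf T hT N hN δ hδ0 hδ
    have hδ' := abs_lt.1 hδ
    have hTL : 0 < T + δ / 2 := by linarith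
    have hTR : 0 < T - δ / 2 := by linarith
    exact totalCurrent_eq_bias_mul_pairing hω hl hβ hγ (by omega) hT hδ0 hδ
      (huniq N (T + δ / 2) (T - δ / 2) hTL hTR) (hμf N (T + δ / 2) (T - δ / 2) hTL hTR) hN
  · intro ω₂ lam β γ hω hl hβ hγ T hT N hN
    exact kdn_identity hω hl.le hβ hγ hN hT

/-- **`OpenChainGreenKubo` modulo the uniform relaxation estimate (UH).** If for all parameters `> 0`, `T > 0`, `N ≥ 2`
there are `δ₀, ϑ, C, c > 0` (`ϑ < 1/T`) such that for every `|δ| ≤ δ₀` the forecast of the total current under the kernels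
at `(T+δ/2, T-δ/2)` relaxes as `|P^δ_t J(z) - m_δ| ≤ C e^{ϑH(z)} e^{-ct}` for some constant `m_δ` (CEHR 2018 (2.5), with
constants uniform in `δ`), then the Kundu–Dhar–Narayan open-chain Green–Kubo identity `OpenChainGreenKubo` holds.
[cite: KunduDharNarayan2009, p. 3] [cite: CuneoEckmannHairerReyBellet2018, Thm 2.13 eq. (2.5)] -/
theorem openChainGreenKubo_of_uniformDecay
    (hUH : ∀ ω₂ lam β γ : ℝ, 0 < ω₂ → 0 < lam → 0 < β → 0 < γ →
      ∀ T : ℝ, 0 < T → ∀ N : ℕ, 2 ≤ N →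
        ∃ δ₀ ϑ C c : ℝ, 0 < δ₀ ∧ 0 < ϑ ∧ ϑ < 1 / T ∧ 0 < c ∧ ∀ δ : ℝ, |δ| ≤ δ₀ → ∃ m : ℝ,
          ∀ (z : PhaseSpace N) (t : ℝ≥0),
            |(∫ y, (∑ i : Fin N, (pinnedChain ω₂ lam β γ).bondCurrent N i y)
                ∂((pinnedChain ω₂ lam β γ).transitionKernel N (T + δ / 2) (T - δ / 2) t z)) - m| ≤
              C * Real.exp (ϑ * (pinnedChain ω₂ lam β γ).hamiltonian N z) * Real.exp (-c * t)) :
    Summit.AtomisticToContinuum.FouriersLaw.Theses.HonestZwanzig.OpenChainGreenKubo :=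
  openChainGreenKubo_of_cont fun ω₂ lam β γ hω hl hβ hγ T hT N hN =>
    tendsto_pairing_of_uniform_decay hω hl hβ hγ hN hT (hUH ω₂ lam β γ hω hl hβ hγ T hT N hN)

end Summit.AtomisticToContinuum.FouriersLaw.Theorems.OpenChainGreenKubo

end
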